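import Summits.AtomisticToContinuum.Crystallization.Theses.SpectralChargeLedger
import Summits.AtomisticToContinuum.Crystallization.Theses.HcpDefectCounting
import Summits.AtomisticToContinuum.Crystallization.Theorems.ChargedEnergyGap.Negative.BlocksBound
import Summits.AtomisticToContinuum.Crystallization.Theorems.SpectralChargeLedgerSummedShellPricingChartShell
import Summits.AtomisticToContinuum.Crystallization.Theorems.SpectralChargeLedgerSummedShellPricingFloorCell

/-!
# Crux `SummedShellPricing` (stmt-AtomisticToContinuum-17044, K1 of route `SpectralChargeLedger`) follows from
# the two cruxes of route `HcpDefectCounting`: `HcpBulkFloor` (stmt-14477) ∧ `HcpDefectCoercivity` (stmt-14476) ⇒ K1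

The route header of `SpectralChargeLedger` records: "HcpDefectCoercivity + HcpBulkFloor (route
HcpDefectCounting) proved would imply K1 at each τ only after a first-shell/radius-4 comparison — not
automatic".  It IS automatic, by two tree facts and two landed sub-goals of line `Sketch`:

* G2 `SummedShellPricingFloorCell.stub_floorCellWindow` (p167998): the floor `N·e(hcp(a,h)) ≤ E_LJ(x)`
  (all finite injective `x`) makes `(a,h)` a global minimiser of `e(hcp(·,·))` (trial blocks of any
  periodic `Q`, `Blocks.exists_block_energy_le`), so the certified window of the relaxed-hcp optimum
  (`SlackRigidityHcpAdmissible.lms_hcpBoxMinimiser_window`, p158430: `h/a ∈ (0.8148, 0.8250)`) puts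
  the floor's cell inside K1's box `|h − a√(2/3)| ≤ a/100`;
* G1 `SummedShellPricingChartShell.stub_chartGoodShellGood` (p168192): a site whose radius-`4`
  neighbourhood is two-way `θ`-matched to relaxed hcp (`Good 4 θ` of `HcpDefectCoercivity`,
  `θ ≤ τ`, `4θ < δ`, `θ ≤ 1/20`) has its open punctured `13/10·a`-shell `τ`-matched BIJECTIVELY to the
  hcp reference 12-shell (K1-good), by the shell enumeration of relaxed Barlow stackings extended to
  the window `34a/25`.

Hence (`stub_ofHcpDefectCounting`, registered sub-goal of the skeleton
`Cruxes/SummedShellPricing/Lines/Sketch.lean`): given the floor's cell `(a,h)` and `τ ∈ (0,1]`, put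
`θ := min τ (min (δ/5) (1/20))` and take `κ` from `HcpDefectCoercivity` (fed with the floor) at `(δ, θ)`;
every K1-τ-bad site is not `Good 4 θ`, so `κ·#B ≤ κ·#{¬Good 4 θ} ≤ E − N·e(hcp(a,h)) ≤ E − N·e⋆`
(`e⋆ = ⨅_Q e(Q) ≤ e(hcp(a,h))`, `ChargedEnergyGapNegative.eStar_le`).  So K1 is a COROLLARY of route
`HcpDefectCounting`'s two cruxes (no new numerics, no definition); all `[folklore]`.
-/

noncomputable section

namespace Summit.AtomisticToContinuum.Crystallization.Theorems.SummedShellPricingOfHcpDefectCounting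

open scoped BigOperators Classical
open Literature.MathematicalPhysics.StatisticalMechanics Literature.Geometry.DiscreteGeometry
open Summit.AtomisticToContinuum.Crystallization.Theorems.ChargedEnergyGapNegative (eStar_le)

/-- Counting through a pointwise implication of badness (cast to `ℝ`): if every element of `B` is
`Bad` and `Bad ⇒ Bad'`, then `#B ≤ #{i // Bad' i}`. [folklore] -/
theorem card_le_natCard_of_imp {N : ℕ} (B : Finset (Fin N)) (Bad Bad' : Fin N → Prop)
    (hB : ∀ i ∈ B, Bad i) (himp : ∀ i, Bad i → Bad' i) :
    (B.card : ℝ) ≤ (Nat.card {i : Fin N // Bad' i} : ℝ) := by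
  rw [Nat.card_eq_fintype_card, Fintype.card_subtype]
  exact_mod_cast Finset.card_le_card fun i hi => Finset.mem_filter.2 ⟨Finset.mem_univ _, himp i (hB i hi)⟩

/-- **`HcpBulkFloor ∧ HcpDefectCoercivity ⇒ SummedShellPricing`** (registered sub-goal
`stub_ofHcpDefectCounting` of line `Sketch`, crux stmt-AtomisticToContinuum-17044): K1 is a corollary
of the two cruxes stmt-14477, stmt-14476 of route `HcpDefectCounting`.  Cell := the floor's `(a,h)`
(in K1's box by G2 `stub_floorCellWindow`); for `τ` put `θ := min τ (min (δ/5) (1/20))` and take `κ`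
from `HcpDefectCoercivity` at `(δ, θ)`; a K1-τ-bad site is not `Good 4 θ` (G1
`stub_chartGoodShellGood`), so `κ·#B ≤ κ·#{¬Good 4 θ} ≤ E − N·e(hcp(a,h)) ≤ E − N·e⋆` (`eStar_le`).
[folklore] -/
theorem stub_ofHcpDefectCounting :
    Summit.AtomisticToContinuum.Crystallization.Theses.HcpDefectCounting.HcpBulkFloor →
    Summit.AtomisticToContinuum.Crystallization.Theses.HcpDefectCounting.HcpDefectCoercivity →
    Summit.AtomisticToContinuum.Crystallization.Theses.SpectralChargeLedger.SummedShellPricing := by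
  intro hF hD δ hδ
  obtain ⟨a, h, ha, hh, hb1, hb2, hb3, hb4, hfloor⟩ := hF
  have hwin := SummedShellPricingFloorCell.stub_floorCellWindow a h ha hh hb1 hb2 hb3 hb4 hfloor
  refine ⟨a, h, hb1, hb2, hwin, fun τ hτ _hτ1 => ?_⟩
  set θ : ℝ := min τ (min (δ / 5) (1 / 20)) with hθdef
  have hθ0 : 0 < θ := by positivity
  have hθτ : θ ≤ τ := min_le_left _ _
  have hθδ : 4 * θ < δ := by
    have : θ ≤ δ / 5 := (min_le_right _ _).trans (min_le_left _ _)
    linarith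
  have hθ20 : θ ≤ 1 / 20 := (min_le_right _ _).trans (min_le_right _ _)
  obtain ⟨κ, hκ, hC⟩ := hD a h ha hh hb1 hb2 hb3 hb4 hfloor δ θ hδ hθ0
  refine ⟨κ, hκ, fun N x hsep B hB => ?_⟩
  have key := hC N x hsep
  simp only at key
  have hcount := card_le_natCard_of_imp B _ _ hB fun i hi hgood =>
    hi (SummedShellPricingChartShell.stub_chartGoodShellGood a h ha hh hb1 hb2 hwin δ θ τ hθ0 hθτ hθδ
      hθ20 N x hsep i hgood)
  have he : (⨅ Q : PeriodicConfiguration 3, Q.energyPerParticle lennardJones) ≤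
      (hcpPeriodicConfiguration ha hh).energyPerParticle lennardJones := eStar_le _
  have hN : (0 : ℝ) ≤ N := Nat.cast_nonneg _
  nlinarith [mul_le_mul_of_nonneg_left hcount hκ.le, mul_le_mul_of_nonneg_left he hN]

/-- The same, curried the other way for citation: **K1 holds if route `HcpDefectCounting`'s floor and
defect coercivity hold.** [folklore] -/
theorem summedShellPricing_of_hcpDefectCounting
    (h : Summit.AtomisticToContinuum.Crystallization.Theses.HcpDefectCounting.HcpBulkFloor ∧ Summit.AtomisticToContinuum.Crystallization.Theses.HcpDefectCounting.HcpDefectCoercivity) :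
    Summit.AtomisticToContinuum.Crystallization.Theses.SpectralChargeLedger.SummedShellPricing :=
  stub_ofHcpDefectCounting h.1 h.2

end Summit.AtomisticToContinuum.Crystallization.Theorems.SummedShellPricingOfHcpDefectCounting

end
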